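import Summits.CriticalPhenomena.CardyFormulaZ2.Theorems.CardyComplexConeEdgePrecompactAtOfX1Ufrs
import Literature.Probability.LatticeModels.MedialWindingBridge

/-!
# Decomposition glue of crux `CardyComplexCone.EdgePrecompact`: X1 → UFRS → `EdgePrecompact`
(route `CardyComplexCone`, crux item stmt-CriticalPhenomena-11387, line `qkz-strip-boundary-arm`;
registered sub-goal `EdgePrecompact_of_subs` of the crux strategist's DECOMPOSITION, lead c5, wave 5)

The crux `EdgePrecompact` (local boundedness (i) and class-wise equicontinuity (ii) of the spin-`1/3` corner
observable on compacts, at scale `δ^{1/3}`) is, after skeleton r4 of the line, the composition of exactly two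
registered open stubs:

* **X1** = `stub_localInnerEnvelopeUI` — the local inner envelope in uniform-integrability tail form
  (research-open core of the crux);
* **UFRS** = `stub_uniformForwardResponseStability` — uniform single-datum forward response stability of the
  medial exploration under a small translation of the Dobrushin data (phase-free RSW/arm technology).

The crux strategist promotes both to route children and closes the crux by the glue proved here,
`EdgePrecompact_of_subs : X1 → UFRS → EdgePrecompact`, in which UFRS is spelled with the translated datum
`shiftData E w` UNFOLDED to the let-bound structure literal
`E' := ⟨meshPoint E.δ w +ᵥ E.Ω, E.δ, meshPoint E.δ w +ᵥ E.arcA, meshPoint E.δ w +ᵥ E.arcB⟩` (so that the child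
statement elaborates in the route file, which does not import the line's vocabulary). Since `shiftData E w` is by
definition that literal, the unfolded UFRS is definitionally the UFRS hypothesis of the landed per-domain
composition `EdgePrecompact_at_of_X1_of_ufrsAt` (file `…EdgePrecompactAtOfX1Ufrs.lean`), and `EdgePrecompact` is by
`Iff.rfl` "for every Dobrushin domain `D`, the conclusion of `EdgePrecompact_at_of_X1_of_ufrsAt D`"; the proof is
that composition at every `D`.

This file is conditional glue (`--supports stmt-CriticalPhenomena-11387`): it concludes the crux decl by name from
the two hypotheses and closes nothing by itself. References: S. Smirnov, Ann. of Math. 172 (2010) §2.2;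
H. Duminil-Copin, S. Smirnov, *Conformal invariance of lattice models*, Clay Math. Proc. 15 (2012) §8.
(buildfix 2026-08-20, 09:4xZ: re-enqueue — the 05:1x/05:2x lake attempt ran while the imports were mid-repair (rc 76 / false-green, never re-queued); the closure is rebuilt and green now; no declaration changed.)
-/

namespace Summit.CriticalPhenomena.CardyFormulaZ2.Cruxes.EdgePrecompact.Split

open MeasureTheory Filter Set Metric ProbabilityTheory
open scoped Topology BigOperators Pointwise
open Literature.Probability.LatticeModels Literature.Probability.Percolation
open Literature.Probability.RandomPlanarGeometry (DobrushinDomain)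
open Summit.CriticalPhenomena.CardyFormulaZ2.Theses.CardyComplexCone
open Summit.CriticalPhenomena.CardyFormulaZ2.Cruxes.EdgePrecompact.QkzStripBoundaryArm

/-- Certificate: the let-bound literal `E'` of the unfolded UFRS hypothesis below is `shiftData E w`, by `rfl`
(so that hypothesis is definitionally the registered stub `stub_uniformForwardResponseStability`, and its
specialisation at `D` is definitionally the UFRS hypothesis of `EdgePrecompact_at_of_X1_of_ufrsAt D`). -/
example (E : DiscreteDobrushin) (w : Site 2) :
    shiftData E w = ⟨meshPoint E.δ w +ᵥ E.Ω, E.δ, meshPoint E.δ w +ᵥ E.arcA, meshPoint E.δ w +ᵥ E.arcB⟩ := rfl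

/-- **Decomposition glue of the crux `EdgePrecompact`** (registered sub-goal `EdgePrecompact_of_subs`):
X1 (`stub_localInnerEnvelopeUI`) → UFRS (`stub_uniformForwardResponseStability`, with `shiftData E w` unfolded to
the let-bound literal `E'`) → `EdgePrecompact`. Proof: the landed per-domain composition
`EdgePrecompact_at_of_X1_of_ufrsAt` at every Dobrushin domain `D` (the unfolded UFRS at `D` is definitionally its
UFRS hypothesis, `E' ≡ shiftData E w`). -/
theorem EdgePrecompact_of_subs : (∀ ε₁ > (0:ℝ), ∃ ε' > (0:ℝ), ∀ (E : DiscreteDobrushin), E.IsZdAdmissible → ∀ v f : Site 2, IsCorner v f → ∀ ρ : ℝ, E.δ ≤ ρ → closedBall (meshPoint E.δ v) ρ ⊆ E.Ω → ∀ A : Set (BondConfig (Site 2)), MeasurableSet[MeasurableSpace.comap (fun ω : BondConfig (Site 2) => ω \ {e | medialPoint E.δ e ∈ ball (meshPoint E.δ v) ρ}) (inferInstance : MeasurableSpace (BondConfig (Site 2)))] A → (bondPercolation (zdGraph 2) half).real A ≤ ε' → ‖∫ ω in A, dartPhaseSum (medialExploration E ω) E.δ (1 / 3) (v, f) ∂(bondPercolation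 (zdGraph 2) half)‖ ≤ ε₁ * (E.δ / ρ) ^ ((1:ℝ) / 3)) → (∀ (D : DobrushinDomain) (K : Set ℂ), IsCompact K → K ⊆ D.carrier → ∀ ρ > (0:ℝ), cthickening (2 * ρ) K ⊆ D.carrier → ∀ ε > (0:ℝ), ∃ η > (0:ℝ), ∃ δ₀ > (0:ℝ), ∀ E : DiscreteDobrushin, E.Ω = D.carrier → E.IsZdAdmissible → E.δ < δ₀ → ∀ v w : Site 2, meshPoint E.δ v ∈ K → ‖meshPoint E.δ w‖ < η → let E' : DiscreteDobrushin := ⟨meshPoint E.δ w +ᵥ E.Ω, E.δ, meshPoint E.δ w +ᵥ E.arcA, meshPoint E.δ w +ᵥ E.arcB⟩; (bondPercolation (zdGraph 2) half).real {ω : BondConfig (Site 2) | ¬ ∀ a a' : Site 2 × Fin 4, ((E.IsStartCorner a ∧ E'.IsStartCorner a') ∨ (a = a' ∧ medialPoint E.δ (cSrc a) ∈ ball (meshPoint E.δ v) ρ ∧ medialPoint E.δ (cTgt a) ∉ ball (meshPoint E.δ v) ρ)) → ∀ n : ℕ, (∀ i < n, medialPoint E.δ (cTgt (cornerOrbit (E.bcBondConfig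 ω) a i)) ∉ ball (meshPoint E.δ v) ρ ∧ E.IsInnerFace (cFace (cornerOrbit (E.bcBondConfig ω) a (i + 1)))) → medialPoint E.δ (cTgt (cornerOrbit (E.bcBondConfig ω) a n)) ∈ ball (meshPoint E.δ v) ρ → ∃ n' : ℕ, (∀ i < n', medialPoint E.δ (cTgt (cornerOrbit (E'.bcBondConfig ω) a' i)) ∉ ball (meshPoint E.δ v) ρ ∧ E'.IsInnerFace (cFace (cornerOrbit (E'.bcBondConfig ω) a' (i + 1)))) ∧ cornerOrbit (E'.bcBondConfig ω) a' n' = cornerOrbit (E.bcBondConfig ω) a n ∧ ∑ i ∈ Finset.range n', turnOf (E'.bcBondConfig ω) (cornerOrbit (E'.bcBondConfig ω) a' i) = ∑ i ∈ Finset.range n, turnOf (E.bcBondConfig ω) (cornerOrbit (E.bcBondConfig ω) a i)} ≤ ε) → EdgePrecompact :=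
  fun hX1 hU D => by
    -- buildfix 2026-08-20: the per-domain lemma is stated with `Polyline.winding`, the crux `EdgePrecompact`
    -- with FermionicObservable's `winding` (two copies of one function until the Literature dedupe; the
    -- bridge lemma is `rfl` afterwards, whence the `first`).
    have h := EdgePrecompact_at_of_X1_of_ufrsAt D hX1 (hU D)
    first
      | exact h
      | simp only [Literature.Probability.LatticeModels.Polyline.winding_eq_winding'] at h; exact h

end Summit.CriticalPhenomena.CardyFormulaZ2.Cruxes.EdgePrecompact.Split
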